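import Summits.Ventures.PercRepro.GenQSevenFiveCorners

/-!
# PercRepro — a spanning non-basis of a simple matroid has at most `q − 2` coloops (night-4, gen 2)

For the type-`2` window (sheet §45): in the balance `Jq M G q 2 = Σ_B (q/(1 + m(B))) − Φ·#{demanding B}` the only terms below
the demand `Φ_q = (q + 2)/(q + 1)` are those with `m(B) ≥ q − 1`, and this file shows they are exactly the BASES: a dependent
spanning set `B` of rank `q ≥ 2` in a simple matroid has a circuit `C ⊆ B`, whose points are not coloops of `B` and span rank
`≥ 2`, while the coloops `K` of `B` add their number to the rank of the rest: `eRk B = eRk (B ∖ K) + |K|`.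

* `eRk_sdiff_coloops_add_card`: `M.eRk B = M.eRk (B ∖ coloopsOf M B) + mTr M B`;
* `mTr_add_two_le_of_not_indep`: `Simple M → B ⊆ gr M → M.eRk B = q → 2 ≤ q → ¬ M.Indep B → mTr M B + 2 ≤ q`;
* `wInf_ge_of_not_indep`: hence `w_∞(B) ≥ 1/(q − 1)`, so the type-`2` term `q·w_∞(B) − Φ_q·dem` of a spanning NON-basis is at
  least `q/(q − 1) − (q + 2)/(q + 1) = 2/((q − 1)(q + 1)) > 0` (`typeTwo_term_pos_of_not_indep`): only bases can be negative
  in the type-`2` balance.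
-/

namespace PercRepro.GenQ

open Finset ThmH SixFour

variable {α : Type*} [DecidableEq α] {M : Matroid α} [M.Finite]

/-- Adding the coloops of `B` to a subset of `B` disjoint from them raises the rank by their number. -/
theorem eRk_union_coloops_add_card {B : Finset α} (hB : B ⊆ gr M) (U : Finset α) (hU : U ⊆ B \ coloopsOf M B) :
    ∀ K : Finset α, K ⊆ coloopsOf M B → M.eRk ((U ∪ K : Finset α) : Set α) = M.eRk (U : Set α) + K.card := by
  intro K
  induction K using Finset.induction_on with
  | empty => intro _; simp
  | insert x K hxK ih =>
    intro hsub
    have hxC : x ∈ coloopsOf M B := hsub (Finset.mem_insert_self x K)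
    have hK : K ⊆ coloopsOf M B := (Finset.subset_insert x K).trans hsub
    have hxB : x ∈ B := (mem_coloopsOf.1 hxC).1
    have hxcl : x ∉ M.closure ((B.erase x : Finset α) : Set α) := (mem_coloopsOf.1 hxC).2
    have hxE : x ∈ M.E := by
      rw [← coe_gr M]
      exact_mod_cast hB hxB
    have hsub' : ((U ∪ K : Finset α) : Set α) ⊆ ((B.erase x : Finset α) : Set α) := by
      intro y hy
      rw [Finset.mem_coe] at hy ⊢
      rcases Finset.mem_union.1 hy with hyU | hyK
      · have := hU hyU
        rw [Finset.mem_sdiff] at this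
        exact Finset.mem_erase.2 ⟨fun h => this.2 (h ▸ hxC), this.1⟩
      · exact Finset.mem_erase.2 ⟨fun h => hxK (h ▸ hyK), (mem_coloopsOf.1 (hK hyK)).1⟩
    have hxcl' : x ∉ M.closure ((U ∪ K : Finset α) : Set α) :=
      fun h => hxcl (M.closure_subset_closure hsub' h)
    rw [Finset.union_insert, Finset.coe_insert, Matroid.eRk_insert_eq_add_one ⟨hxE, hxcl'⟩, ih hK,
      Finset.card_insert_of_notMem hxK]
    push_cast
    ring

/-- **`eRk B = eRk (B ∖ coloops) + m(B)`.** -/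
theorem eRk_sdiff_coloops_add_card {B : Finset α} (hB : B ⊆ gr M) :
    M.eRk (B : Set α) = M.eRk ((B \ coloopsOf M B : Finset α) : Set α) + mTr M B := by
  have h := eRk_union_coloops_add_card hB (B \ coloopsOf M B) (subset_refl _) (coloopsOf M B) (subset_refl _)
  rw [Finset.sdiff_union_of_subset (fun _ hx => (mem_coloopsOf.1 hx).1)] at h
  exact h

/-- The points of a circuit inside `B` are not coloops of `B`. -/
theorem notMem_coloopsOf_of_mem_isCircuit {B : Finset α} {C : Set α} (hC : M.IsCircuit C) (hCB : C ⊆ (B : Set α))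
    {e : α} (he : e ∈ C) : e ∉ coloopsOf M B := by
  intro hcol
  have h1 := hC.mem_closure_sdiff_singleton_of_mem he
  have hsub : C \ {e} ⊆ ((B.erase e : Finset α) : Set α) := by
    intro y hy
    rw [Finset.mem_coe, Finset.mem_erase]
    exact ⟨hy.2, hCB hy.1⟩
  exact (mem_coloopsOf.1 hcol).2 (M.closure_subset_closure hsub h1)

/-- **A spanning non-basis of a simple matroid has at most `q − 2` coloops** (`q ≥ 2`). -/
theorem mTr_add_two_le_of_not_indep (hs : Simple M) {B : Finset α} (hB : B ⊆ gr M) {q : ℕ}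
    (hr : M.eRk (B : Set α) = (q : ℕ∞)) (hq : 2 ≤ q) (hdep : ¬ M.Indep (B : Set α)) : mTr M B + 2 ≤ q := by
  have hBE : (B : Set α) ⊆ M.E := by
    rw [← coe_gr M]
    exact_mod_cast hB
  have hDep : M.Dep (B : Set α) := Matroid.dep_iff.2 ⟨hdep, hBE⟩
  obtain ⟨C, hCB, hC⟩ := hDep.exists_isCircuit_subset
  obtain ⟨e, heC⟩ := hC.nonempty
  -- a second point of `C`: `C` is not a loop, since `B` has two points and `M` is simple
  have hcard : 2 ≤ B.card := by
    have h1 : (q : ℕ∞) ≤ (B : Set α).encard := hr ▸ M.eRk_le_encard _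
    rw [Set.encard_coe_eq_coe_finsetCard] at h1
    exact_mod_cast (le_trans (by exact_mod_cast hq) h1 : (2 : ℕ∞) ≤ B.card)
  obtain ⟨f, hfC, hfe⟩ : ∃ f ∈ C, f ≠ e := by
    by_contra hcon
    push Not at hcon
    have hCe : C = {e} := Set.Subset.antisymm (fun y hy => hcon y hy) (Set.singleton_subset_iff.2 heC)
    have hloop : M.IsLoop e := Matroid.singleton_isCircuit.1 (hCe ▸ hC)
    obtain ⟨g, hgB, hge⟩ : ∃ g ∈ B, g ≠ e := by
      obtain ⟨a, ha, b, hb, hab⟩ := Finset.one_lt_card.1 (by omega : 1 < B.card)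
      by_cases hae : a = e
      · exact ⟨b, hb, fun h => hab (hae.trans h.symm)⟩
      · exact ⟨a, ha, hae⟩
    have heE : e ∈ M.E := hBE (hCB heC)
    have hgE : g ∈ M.E := hBE (Finset.mem_coe.2 hgB)
    have h2 : M.eRk ({e, g} : Set α) = 2 := hs e heE g hgE (Ne.symm hge)
    have h3 : M.eRk ({e, g} : Set α) ≤ 1 := by
      have hmem : e ∈ M.closure ({g} : Set α) := hloop.mem_closure _
      have : M.eRk (insert e ({g} : Set α)) = M.eRk ({g} : Set α) := by
        rw [← Matroid.eRk_insert_closure_eq, Set.insert_eq_of_mem hmem, Matroid.eRk_closure_eq]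
      calc M.eRk ({e, g} : Set α) = M.eRk ({g} : Set α) := this
        _ ≤ ({g} : Set α).encard := M.eRk_le_encard _
        _ = 1 := Set.encard_singleton g
    rw [h2] at h3
    exact absurd h3 (by norm_num)
  -- `e, f ∈ B ∖ coloops`, so that set has rank `≥ 2`
  have heU : e ∈ B \ coloopsOf M B :=
    Finset.mem_sdiff.2 ⟨Finset.mem_coe.1 (hCB heC), notMem_coloopsOf_of_mem_isCircuit hC hCB heC⟩
  have hfU : f ∈ B \ coloopsOf M B :=
    Finset.mem_sdiff.2 ⟨Finset.mem_coe.1 (hCB hfC), notMem_coloopsOf_of_mem_isCircuit hC hCB hfC⟩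
  have hpair : ({e, f} : Set α) ⊆ ((B \ coloopsOf M B : Finset α) : Set α) := by
    intro y hy
    rcases hy with rfl | rfl
    · exact Finset.mem_coe.2 heU
    · exact Finset.mem_coe.2 hfU
  have h2 : (2 : ℕ∞) ≤ M.eRk ((B \ coloopsOf M B : Finset α) : Set α) := by
    have := hs e (hBE (hCB heC)) f (hBE (hCB hfC)) (Ne.symm hfe)
    rw [← this]
    exact M.eRk_mono hpair
  -- assemble in `ℕ`
  have hsum := eRk_sdiff_coloops_add_card (M := M) hB
  rw [hr] at hsum
  have hfin : M.eRk ((B \ coloopsOf M B : Finset α) : Set α) ≠ ⊤ := by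
    intro htop
    rw [htop, top_add] at hsum
    exact ENat.coe_ne_top _ hsum
  obtain ⟨r, hr'⟩ := ENat.ne_top_iff_exists.1 hfin
  rw [← hr'] at hsum h2
  have hq' : q = r + mTr M B := by exact_mod_cast hsum
  have h2' : 2 ≤ r := by exact_mod_cast h2
  omega

/-- A spanning non-basis has `w_∞ ≥ 1/(q − 1)`. -/
theorem wInf_ge_of_not_indep (hs : Simple M) {B : Finset α} (hB : B ⊆ gr M) {q : ℕ}
    (hr : M.eRk (B : Set α) = (q : ℕ∞)) (hq : 2 ≤ q) (hdep : ¬ M.Indep (B : Set α)) :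
    1 / ((q : ℚ) - 1) ≤ wInf M B := by
  have h := mTr_add_two_le_of_not_indep hs hB hr hq hdep
  unfold wInf
  have h1 : (0 : ℚ) < 1 + (mTr M B : ℚ) := by positivity
  have h2 : (0 : ℚ) < (q : ℚ) - 1 := by
    have : (2 : ℚ) ≤ q := by exact_mod_cast hq
    linarith
  rw [div_le_div_iff₀ h2 h1]
  have : (mTr M B : ℚ) + 2 ≤ q := by exact_mod_cast h
  linarith

/-- **Only bases can be negative in the type-`2` balance**: the term of a spanning non-basis is at least
`2/((q − 1)(q + 1))`, whatever its demand. -/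
theorem typeTwo_term_pos_of_not_indep (hs : Simple M) {B G : Finset α} (hG : G ⊆ gr M) (hBG : B ⊆ G) {q : ℕ}
    (hr : M.eRk (B : Set α) = (q : ℕ∞)) (hq : 2 ≤ q) (hdep : ¬ M.Indep (B : Set α)) :
    2 / (((q : ℚ) - 1) * ((q : ℚ) + 1)) ≤
      ((q : ℚ) + 2 - (2 : ℕ)) * wInf M B - (((q : ℚ) + 2) / ((q : ℚ) + 1)) * dem M G 2 B := by
  have hw := wInf_ge_of_not_indep hs (hBG.trans hG) hr hq hdep
  have hq' : (2 : ℚ) ≤ q := by exact_mod_cast hq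
  have hdem : dem M G 2 B ≤ 1 := by
    unfold dem
    split_ifs <;> norm_num
  have hdem0 : 0 ≤ dem M G 2 B := by
    unfold dem
    split_ifs <;> norm_num
  have h1 : (0 : ℚ) < (q : ℚ) - 1 := by linarith
  have h2 : (0 : ℚ) < (q : ℚ) + 1 := by linarith
  have hkey : ((q : ℚ) + 2 - (2 : ℕ)) * wInf M B - (((q : ℚ) + 2) / ((q : ℚ) + 1)) * dem M G 2 B ≥
      (q : ℚ) * (1 / ((q : ℚ) - 1)) - ((q : ℚ) + 2) / ((q : ℚ) + 1) := by
    have hq0 : (0 : ℚ) ≤ q := by linarith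
    have hphi : (0 : ℚ) ≤ ((q : ℚ) + 2) / ((q : ℚ) + 1) := by positivity
    push_cast
    nlinarith [mul_le_mul_of_nonneg_left hw hq0, mul_le_mul_of_nonneg_left hdem hphi]
  refine le_trans (le_of_eq ?_) hkey
  field_simp
  ring

end PercRepro.GenQ
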